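import Summits.CriticalPhenomena.Ising3DConformalLimit.Theorems.LinkingParityCirclesSpinRatioMoebiusExistenceAvatars
import Summits.CriticalPhenomena.Ising3DConformalLimit.Theorems.LinkingParityCirclesSpinRatioMoebiusLineTightness
import Summits.CriticalPhenomena.Ising3DConformalLimit.Theorems.HyperoctahedralRPExistsScaleCovariantLimitFoldedCurrentUniqueness
import HarnessLib

/-!
# Crux `LinkingParityCircles.SpinRatioMoebius` (stmt-CriticalPhenomena-4530) — root census of line `registered`

Lead c4 of line `registered`, 2026-08-17.  Theorem-only file (no definition, no named fact, no `sorry`).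

The two open stubs of the registered skeleton are kernel-equivalent to open items of sibling routes
(`ratioLimits_iff_CCIRatioLimit`, `CCIRatioLimit_iff_existsScaleCovariantLimit`, p157687/p157890;
`ratioInversion_iff_CCIRatioInversion_of_ratioLimits`, p160148).  Route `HyperoctahedralRP`'s existence crux has
meanwhile been split EXACTLY into its two finest open items
(`FoldedCurrentRepulsion.crux_iff_doubling_and_totallyDisconnected`, p139907:
`ExistsScaleCovariantLimit ⇔ TwoPointDoubling (stmt-6150) ∧ ClusterSetTotallyDisconnected (stmt-4659)`).
Composing, this file records where the crux sits among the ROOT items of the sub-problem's DAG: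

* `ratioLimits_iff_doubling_and_totallyDisconnected` — Stub 1 (existence of the pairing-ratio limits)
  ⇔ 6150 ∧ 4659;
* `SpinRatioMoebius_iff_roots` — **the crux ⇔ 6150 ∧ 4659 ∧ 4840** (`TwoPointDoubling`, `ClusterSetTotallyDisconnected`,
  `CurrentConnectionInvariance.RatioInversionInvariance`);
* `SpinRatioMoebius_of_roots_of_inversionUpgrade` — the crux ⇐ 6150 ∧ 4659 ∧ 1982 (`InversionUpgradeNormalised`);
* `twoPointDoubling_of_SpinRatioMoebius`, `clusterSetTotallyDisconnected_of_SpinRatioMoebius`,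
  `CCIRatioInversion_of_SpinRatioMoebius` — each root item is NECESSARY for the crux.

References: H. Duminil-Copin, ICM 2022, §8.4 [DuminilCopinICM2022]; M. Aizenman, H. Duminil-Copin, Ann. of Math. 194
(2021), arXiv:1912.07973, Remark 5.10 [AizenmanDuminilCopinAnnals2021].
-/

noncomputable section

namespace Summit.CriticalPhenomena.Ising3DConformalLimit.Cruxes.SpinRatioMoebius.Birth

open Literature.Probability.LatticeModels Filter Set
open Summit.CriticalPhenomena.Ising3DConformalLimit.Theses
open Summit.CriticalPhenomena.Ising3DConformalLimit.Cruxes.ExistsScaleCovariantLimit.FoldedCurrentRepulsion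
  (crux_iff_doubling_and_totallyDisconnected)
open scoped Topology

/-- **Stub 1 of line `registered` ⇔ item 6150 ∧ item 4659**: the pairing ratios of the critical `ℤ³` Ising model have
locally uniform limits at every level iff the axial two-point function doubles at all scales AND the cluster set of the
self-normalised correlators is totally disconnected. [folklore] -/
theorem ratioLimits_iff_doubling_and_totallyDisconnected :
    (∃ q : CorrFamily 3, ∀ m : ℕ, TendstoLocallyUniformlyOn (fun (δ : ℝ) (x : Fin (m + m) → EuclideanSpace ℝ (Fin 3)) =>
      criticalCorr 3 (m + m) (fun i => latticeApprox δ (x i)) /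
        ∏ j : Fin m, criticalCorr 3 2 ![latticeApprox δ (x (Fin.castAdd m j)), latticeApprox δ (x (Fin.natAdd m j))])
      (q (m + m)) (𝓝[>] (0 : ℝ)) (NonCoincident 3 (m + m))) ↔
      MirrorHoelderCompactness.TwoPointDoubling ∧ ClusterRigidity.ClusterSetTotallyDisconnected :=
  (ratioLimits_iff_CCIRatioLimit.trans CCIRatioLimit_iff_existsScaleCovariantLimit).trans
    crux_iff_doubling_and_totallyDisconnected

/-- **Root census of the crux**: `SpinRatioMoebius ⇔ TwoPointDoubling (6150) ∧ ClusterSetTotallyDisconnected (4659) ∧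
RatioInversionInvariance (4840)` — bare existence is exactly doubling plus cluster-set rigidity, and the whole conformal
content beyond it is the asymptotic inversion invariance of the telescoping ratios on the lattice. [folklore] -/
theorem SpinRatioMoebius_iff_roots :
    Summit.CriticalPhenomena.Ising3DConformalLimit.Theses.LinkingParityCircles.SpinRatioMoebius ↔ Summit.CriticalPhenomena.Ising3DConformalLimit.Theses.MirrorHoelderCompactness.TwoPointDoubling ∧ Summit.CriticalPhenomena.Ising3DConformalLimit.Theses.ClusterRigidity.ClusterSetTotallyDisconnected ∧ Summit.CriticalPhenomena.Ising3DConformalLimit.Theses.CurrentConnectionInvariance.RatioInversionInvariance := by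
  rw [SpinRatioMoebius_iff_CCI_items, CCIRatioLimit_iff_existsScaleCovariantLimit,
    crux_iff_doubling_and_totallyDisconnected, and_assoc]

/-- **The crux from the three root items 6150, 4659 and 1982** (`InversionUpgradeNormalised` applied to the pinned
limit that doubling and cluster-set rigidity provide). [folklore] -/
theorem SpinRatioMoebius_of_roots_of_inversionUpgrade (hD : MirrorHoelderCompactness.TwoPointDoubling)
    (hT : ClusterRigidity.ClusterSetTotallyDisconnected) (hU : HyperoctahedralRP.InversionUpgradeNormalised) :
    LinkingParityCircles.SpinRatioMoebius :=
  SpinRatioMoebius_of_ratioLimits_of_inversionUpgrade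
    (ratioLimits_iff_doubling_and_totallyDisconnected.2 ⟨hD, hT⟩) hU

/-- Item 6150 `TwoPointDoubling` is NECESSARY for the crux. [folklore] -/
theorem twoPointDoubling_of_SpinRatioMoebius (h : LinkingParityCircles.SpinRatioMoebius) :
    MirrorHoelderCompactness.TwoPointDoubling :=
  (SpinRatioMoebius_iff_roots.1 h).1

/-- Item 4659 `ClusterSetTotallyDisconnected` is NECESSARY for the crux. [folklore] -/
theorem clusterSetTotallyDisconnected_of_SpinRatioMoebius (h : LinkingParityCircles.SpinRatioMoebius) :
    ClusterRigidity.ClusterSetTotallyDisconnected :=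
  (SpinRatioMoebius_iff_roots.1 h).2.1

/-- Item 4840 `RatioInversionInvariance` is NECESSARY for the crux. [folklore] -/
theorem CCIRatioInversion_of_SpinRatioMoebius (h : LinkingParityCircles.SpinRatioMoebius) :
    CurrentConnectionInvariance.RatioInversionInvariance :=
  (SpinRatioMoebius_iff_roots.1 h).2.2

/-- **Stub 2 of line `registered` in root currency**: given doubling (6150) and cluster-set rigidity (4659), the
asymptotic lattice inversion invariance of the pairing ratios is EQUIVALENT to item 4840. [folklore] -/
theorem ratioInversion_iff_CCIRatioInversion_of_roots (hD : MirrorHoelderCompactness.TwoPointDoubling)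
    (hT : ClusterRigidity.ClusterSetTotallyDisconnected) :
    (∀ (m : ℕ), ∀ x ∈ NonCoincident 3 (m + m), (∀ i, x i ≠ 0) → Tendsto (fun δ : ℝ =>
      criticalCorr 3 (m + m) (fun i => latticeApprox δ (EuclideanGeometry.inversion 0 1 (x i))) /
          (∏ j : Fin m, criticalCorr 3 2 ![latticeApprox δ (EuclideanGeometry.inversion 0 1 (x (Fin.castAdd m j))),
            latticeApprox δ (EuclideanGeometry.inversion 0 1 (x (Fin.natAdd m j)))]) -
        criticalCorr 3 (m + m) (fun i => latticeApprox δ (x i)) /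
          (∏ j : Fin m, criticalCorr 3 2 ![latticeApprox δ (x (Fin.castAdd m j)), latticeApprox δ (x (Fin.natAdd m j))]))
      (𝓝[>] (0 : ℝ)) (𝓝 0)) ↔ CurrentConnectionInvariance.RatioInversionInvariance :=
  ratioInversion_iff_CCIRatioInversion_of_ratioLimits (ratioLimits_iff_doubling_and_totallyDisconnected.2 ⟨hD, hT⟩)

end Summit.CriticalPhenomena.Ising3DConformalLimit.Cruxes.SpinRatioMoebius.Birth

end
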